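import Literature.Analysis.FluidPDE.MikadoDirectionFamilies
import HarnessLib

/-!
# Geometric Lemma II for each of the 27 rotated frames (De Lellis–Kwon 2022, §3.4.1:
# "Lemma 3.3 is just applied 27 times")

Analysis/FluidPDE support file on the discharge path of `Torus.DeLellisKwon2022_thm11`
(everything proved; no named facts). De Lellis–Kwon, Anal. PDE 15 (2022) = arXiv:2006.06482, §3.4.1,
choose the energy weights through Lemma 3.3 (Geometric Lemma II) applied to each frame family
`𝓕^{[n],φ} = {A_j f₆, A_j f₇, A_j f₈, A_j f₉}` ("in fact Lemma 3.3 is just applied 27 times, taking into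
consideration that `[n] ∈ ℤ₃³`"). `SixDirectionGeometricLemma` proves Lemma 3.3 for an abstract frame
(`DLK.geometric_lemma_frame`: affine coefficients `DLK.frameCoeff f N₀ k`, `u = ∑ₖ Γ_k(u) f_k`,
`Γ_k ≥ N₀` on `|u| ≤ N₀`); this file instantiates it with the frames of `MikadoDirectionFamilies`:

* `DLK.frameDir j k ∈ ℝ³` — the real vector of `DLK.dir (j, 6 + k)`, `k : Fin 4`;
* `DLK.frameDir_orthogonal`, `DLK.one_le_norm_frameDir`, `DLK.frameDir_three` — the hypotheses of
  Lemma 3.3 ((3.4): orthogonal frame of integer vectors of length `≥ 1`, `f₃ = -(f₀ + f₁ + f₂)`), read off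
  the decidable facts `DLK.dir_frame_orthogonal`, `DLK.one_le_dot3_dir_self`, `DLK.dir_frame_sum`;
* `DLK.geometric_lemma_frame_family j` — **Lemma 3.3 for `𝓕^{j,φ}`**: for every `N₀ ≥ 0` the affine
  smooth `Γ_k = frameCoeff (frameDir j) N₀ k` satisfy `Γ_k(u) ≥ N₀` for `|u| ≤ N₀` and
  `u = ∑ₖ Γ_k(u) (A_j f_{6+k})`.

## References

* C. De Lellis, H. Kwon, Anal. PDE 15 (2022) = arXiv:2006.06482, Lemma 3.3, §3.4.1. [DelellisKwon2022]
-/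

noncomputable section

open Set Function
open scoped InnerProductSpace RealInnerProductSpace ContDiff

namespace Literature.Analysis.FluidPDE

namespace DLK

/-- Euclidean `ℝ³`, local notation. -/
local notation "ℝ³" => EuclideanSpace ℝ (Fin 3)

variable (j : Fin 27)

/-- The frame index `k : Fin 4` as the family index `6 + k : Fin 10`. [folklore] -/
def frameIdx (k : Fin 4) : Fin 10 := ⟨6 + k, by omega⟩

/-- The frame directions `A_j f_{6+k}` as vectors of `ℝ³`. [cite: DelellisKwon2022, §3.1 (𝓕^{j,φ})] -/
def frameDir (k : Fin 4) : ℝ³ := WithLp.toLp 2 fun a => (dir (j, frameIdx k) a : ℝ)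

/-- Coordinates of the frame directions. [folklore] -/
@[simp] theorem frameDir_apply (k : Fin 4) (a : Fin 3) : frameDir j k a = (dir (j, frameIdx k) a : ℝ) := rfl

/-- Inner products of frame directions are the integer dot products. [folklore] -/
theorem inner_frameDir (k k' : Fin 4) : ⟪frameDir j k, frameDir j k'⟫_ℝ = (dot3 (dir (j, frameIdx k)) (dir (j, frameIdx k')) : ℝ) := by
  rw [dot3_eq, EuclideanSpace.inner_eq_star_dotProduct]
  simp [dotProduct, Fin.sum_univ_three, frameDir, mul_comm]

/-- `frameIdx 0 = 6`, `1 ↦ 7`, `2 ↦ 8`, `3 ↦ 9`. [folklore] -/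
theorem frameIdx_vals : frameIdx 0 = 6 ∧ frameIdx 1 = 7 ∧ frameIdx 2 = 8 ∧ frameIdx 3 = 9 := by
  refine ⟨rfl, rfl, rfl, rfl⟩

/-- **The frame is orthogonal** ((3.4), from `DLK.dir_frame_orthogonal`). [cite: DelellisKwon2022, §3.1 (3.4)] -/
theorem frameDir_orthogonal :
    ⟪frameDir j 0, frameDir j 1⟫_ℝ = 0 ∧ ⟪frameDir j 0, frameDir j 2⟫_ℝ = 0 ∧ ⟪frameDir j 1, frameDir j 2⟫_ℝ = 0 := by
  obtain ⟨h1, h2, h3⟩ := dir_frame_orthogonal j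
  refine ⟨?_, ?_, ?_⟩ <;> rw [inner_frameDir] <;> simp only [frameIdx_vals.1, frameIdx_vals.2.1, frameIdx_vals.2.2.1]
  · exact_mod_cast h1
  · exact_mod_cast h2
  · exact_mod_cast h3

/-- **The frame directions have length `≥ 1`** (nonzero integer vectors). [cite: DelellisKwon2022, Lemma 3.3 (|f_k| ≥ 1)] -/
theorem one_le_norm_frameDir (k : Fin 4) : 1 ≤ ‖frameDir j k‖ := by
  have hsq : (1 : ℝ) ≤ ‖frameDir j k‖ ^ 2 := by
    rw [← real_inner_self_eq_norm_sq, inner_frameDir]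
    exact_mod_cast one_le_dot3_dir_self (j, frameIdx k)
  nlinarith [norm_nonneg (frameDir j k)]

/-- **`f₃ = -(f₀ + f₁ + f₂)`** for the frame ((3.4), from `DLK.dir_frame_sum`). [cite: DelellisKwon2022, §3.1 (3.4)] -/
theorem frameDir_three : frameDir j 3 = -(frameDir j 0 + frameDir j 1 + frameDir j 2) := by
  ext a
  have h := congrFun (dir_frame_sum j) a
  simp only [Pi.neg_apply, Pi.add_apply] at h
  rw [frameDir_apply, PiLp.neg_apply, PiLp.add_apply, PiLp.add_apply, frameDir_apply, frameDir_apply, frameDir_apply]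
  rw [frameIdx_vals.1, frameIdx_vals.2.1, frameIdx_vals.2.2.1, frameIdx_vals.2.2.2, h]
  push_cast
  ring

/-- **De Lellis–Kwon 2022, Lemma 3.3 (Geometric Lemma II) for the frame family `𝓕^{j,φ}`**: for every
`N₀ ≥ 0` the affine smooth functions `Γ_k = DLK.frameCoeff (frameDir j) N₀ k` satisfy `Γ_k(u) ≥ N₀`
whenever `|u| ≤ N₀`, and `u = ∑ₖ Γ_k(u) (A_j f_{6+k})` for all `u ∈ ℝ³`. [cite: DelellisKwon2022, Lemma 3.3 and §3.4.1] -/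
theorem geometric_lemma_frame_family {N₀ : ℝ} (hN₀ : 0 ≤ N₀) :
    (∀ k, ContDiff ℝ ∞ (frameCoeff (frameDir j) N₀ k)) ∧
      (∀ k (u : ℝ³), ‖u‖ ≤ N₀ → N₀ ≤ frameCoeff (frameDir j) N₀ k u) ∧
      ∀ u : ℝ³, u = ∑ k, frameCoeff (frameDir j) N₀ k u • frameDir j k := by
  obtain ⟨h01, h02, h12⟩ := frameDir_orthogonal j
  exact geometric_lemma_frame h01 h02 h12 (one_le_norm_frameDir j) (frameDir_three j) hN₀

end DLK

end Literature.Analysis.FluidPDE
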